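import Summits.HodgeConjecture.HodgeConjecture.Cruxes.BlochSeedDiscOne.DeepLayerLaws
import Summits.HodgeConjecture.HodgeConjecture.Cruxes.BlochSeedDiscOne.SigmaH
import Summits.HodgeConjecture.HodgeConjecture.Cruxes.BlochSeedDiscOne.RingTwoMassLaw
import Summits.HodgeConjecture.HodgeConjecture.Cruxes.BlochSeedDiscOne.RingTwoEffEmpty

/-!
# ShellLedger — the SHELL FORM of the statement of record `SPlus 14 σ_H 0`: shells 1 and 2 CLOSED in the kernel, the item is the conjunction
# of the twelve open shells 3 … 14 (plan-lens-HodgeAV-strengthen g17; director-hodge R19.682 «the composition file (shell form) is yours»)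

Token: line stmt-HodgeConjecture-18881 Cruxes/BlochSeedDiscOne/Lines/birth.lean 814a6a70c14e831a stub_rung_pad4_seedAt.

Version: v1.0 (landed by plan-lens-HodgeAV-strengthen g18, 2026-08-31: the g17 draft 67c5aca1f0bfa036 with the officer's one-line proof fix of
`nmass_le_copies` (idea-crit-6 g22 pre-plate, bus l.13524 ∕ l.13541); statements unchanged; farm `lean check` rc 0, 26 theorems, 0 sorry, axioms standard).

LETTER-MODEL BOOKKEEPING ONLY (`DepthBoundA4.Design`).  Letters ≠ sheaves ≠ the kernel of a SEED; a closed shell of `SPlus 14 σ_H 0` is READING-1 bookkeeping,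
one of fourteen, and registers nothing on 18881 ∕ H2; nothing here is proved toward HC ∕ HC_CM ∕ HC_AV ∕ №4 ∕ 26512 ∕ 18881 ∕ H2.  `Nonex 14 199 8` stays REFUTED.

THE COMPOSITION (one writer; ingredients all kernel, in three other seats' files + this seat's `DeepLayerLaws` §7):
* SHELL `c` = `DeepLayerLaws.RingShellB h Budget c` (designs on rings `≤ c` touching ring `c`), ROOM = `RingRoomB h Budget c` (rings `≤ c`);
  `sPlusB_of_shells` ∕ `shells_of_sPlusB` ∕ `sPlusB_iff_ringRoomB` (budget-generic, `DeepLayerLaws` §7).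
* SHELL 1, every height, EVERY budget: `RingTwoEffEmpty.ring1_mu_eq_zero_allHeights : OnAlphabet h → Ring1 → Disj → RuleD → μ = 0` (plan-lens-HodgeAV-strengthen g16;
  no (A1), no Hall, no budget; `Ring1 D` and `RingLe 1 D` have the same body).
* SHELL 2, every height, σ-currency: `RingTwoMassLaw.ClassLaw.sPlus_ring2 (σ) (28·copies ≤ σ D) : OnAlphabet h → Ring2 → Disj → (A1) → RuleD → HallPlusUp 8 → μ ≠ 0 →
  BudgetClause σ 0 D → False` (plan-lens-HodgeAV-dual g15, v7 e3ea2a21adcd: cube covering, `ring2_door_shut : 116 < copies + rank`), with `SigmaH.diag_le_sigmaH : 28·copies ≤ σ_H`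
  (hsemireg seats, tree `SigmaH.lean`); `Ring2 D` and `RingLe 2 D` have the same body.
* SHELL 2, COPIES currency: `nmass_ge_59 : 59 ≤ Nmass` closes `CopiesLe B` for `B ≤ 58` ONLY (kernel); dual's pen covering gives copies ≥ 107; `B ∈ [107, 116]` is OPEN as typed
  (officer idea-crit-6 g22 l.13433 (b)) — recorded, not claimed.
RESULTS: `shell_one_closed`, `ringRoom_two_closed_sigma ∕ _sigmaH`, `shell_two_closed_sigmaH`, `sPlus_two_sigmaH : SPlus 2 sigmaH 0` (the height-2 ITEM in the currency of record),
`ringRoom_two_closed_copiesLe (B ≤ 58)`, `copies_ge_59_of_ring_two`, the RING-INDEPENDENT N-budget `nmass_le_58_of_budget` (§3b: `Σ_N m ≤ 58` under the door of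
record at EVERY shell — director R19.683 (S3-3)), and the RESIDUAL LEDGER `sPlus_fourteen_sigmaH_iff_shells_from_three :
SPlus 14 sigmaH 0 ↔ ∀ c, 3 ≤ c → c ≤ 14 → RingShellB 14 (BudgetClause sigmaH 0) c` (σ-generic: `sPlusB_sigma_iff_shells_from_three`), plus the dictionary of each open shell to
the height-`c` item `FloorFreeB c (BudgetClause sigmaH 0)` (`shell_sigmaH_iff_floorFreeB`, from `ringShellB_iff_floorFreeB` + `budgetClause_shiftD` + `sigmaH_shiftD`).
Imports: `DeepLayerLaws`, `SigmaH`, `RingTwoMassLaw`, `RingTwoEffEmpty` — nothing else from `Cruxes∕`.  No `axiom` ∕ `instance` ∕ `sorry` ∕ `native_decide` ∕ `decide`.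
-/

set_option linter.dupNamespace false
set_option autoImplicit false

namespace Summit.HodgeConjecture.HodgeConjecture.Cruxes.BlochSeedDiscOne.ShellLedger

open Summit.HodgeConjecture.HodgeConjecture.Cruxes.BlochSeedDiscOne.DepthBoundA4
open Summit.HodgeConjecture.HodgeConjecture.Cruxes.BlochSeedDiscOne.LeggedFloor (RuleD Disj)
open Summit.HodgeConjecture.HodgeConjecture.Cruxes.BlochSeedDiscOne.HeightTower (shiftD)
open Summit.HodgeConjecture.HodgeConjecture.Cruxes.BlochSeedDiscOne.RuleDPlate
  (HallPlusUp SPlusB SPlus CopiesLe FloorFreeB BudgetClause budgetClause_shiftD)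
open Summit.HodgeConjecture.HodgeConjecture.Cruxes.BlochSeedDiscOne.DeepLayerLaws
  (RingLe TouchesP RingRoomB RingShellB ringShellB_of_ringRoomB sPlusB_iff_ringRoomB sPlusB_of_shells shells_of_sPlusB ringRoomB_succ_iff
    ringRoomB_iff_sPlusB ringShellB_iff_floorFreeB)
open Summit.HodgeConjecture.HodgeConjecture.Cruxes.BlochSeedDiscOne.SigmaH (sigmaH diag_le_sigmaH sigmaH_shiftD)
open Summit.HodgeConjecture.HodgeConjecture.Cruxes.BlochSeedDiscOne.RingTwoMassLaw (Nmass budget_eq_two_Nmass)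
open Summit.HodgeConjecture.HodgeConjecture.Cruxes.BlochSeedDiscOne.RingTwoMassLaw.ClassLaw (sPlus_ring2 ring2_door_shut nmass_ge_59)
open Summit.HodgeConjecture.HodgeConjecture.Cruxes.BlochSeedDiscOne.RingTwoEffEmpty (ring1_mu_eq_zero_allHeights)

/-! ## §1 Shell 1 — closed at every height for EVERY budget -/

/-- ROOM 1 (rings ≤ 1) is closed for every budget predicate: `μ = 0` there, budget-free (`RingTwoEffEmpty`). -/
theorem ringRoom_one_closed (h : ℤ) (Budget : Design → Prop) : RingRoomB h Budget 1 :=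
  fun _D hA hd _ hr _ _ hμ _ hR => hμ (ring1_mu_eq_zero_allHeights hA hR hd hr)

/-- SHELL 1 is closed for every budget predicate. -/
theorem shell_one_closed (h : ℤ) (Budget : Design → Prop) : RingShellB h Budget 1 :=
  ringShellB_of_ringRoomB (ringRoom_one_closed h Budget)

/-! ## §2 Shell 2 — closed in the σ-currency for every `σ ≥ 28·copies`, in particular `σ_H` (dual g15 `RingTwoMassLaw` v7) -/

/-- ROOM 2 (rings ≤ 2) is closed for the budget clause of ANY `σ` dominating `28·copies`. -/
theorem ringRoom_two_closed_sigma (h : ℤ) (σ : Design → ℤ) (hσ : ∀ D : Design, 28 * (D.copies : ℤ) ≤ σ D) :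
    RingRoomB h (BudgetClause σ 0) 2 :=
  fun D hA hd h1 hr _ hp hμ hb hR => sPlus_ring2 σ (hσ D) hA hR hd h1 hr hp hμ hb

/-- ROOM 2 is closed in the currency of record `σ_H`. -/
theorem ringRoom_two_closed_sigmaH (h : ℤ) : RingRoomB h (BudgetClause sigmaH 0) 2 :=
  ringRoom_two_closed_sigma h sigmaH diag_le_sigmaH

/-- SHELL 2 is closed in the currency of record. -/
theorem shell_two_closed_sigmaH (h : ℤ) : RingShellB h (BudgetClause sigmaH 0) 2 :=
  ringShellB_of_ringRoomB (ringRoom_two_closed_sigmaH h)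

/-- SHELL 2 is closed for the budget clause of any `σ ≥ 28·copies`. -/
theorem shell_two_closed_sigma (h : ℤ) (σ : Design → ℤ) (hσ : ∀ D : Design, 28 * (D.copies : ℤ) ≤ σ D) :
    RingShellB h (BudgetClause σ 0) 2 :=
  ringShellB_of_ringRoomB (ringRoom_two_closed_sigma h σ hσ)

/-- **THE HEIGHT-2 ITEM IN THE CURRENCY OF RECORD: `SPlus 2 σ_H 0`.** -/
theorem sPlus_two_sigmaH : SPlus 2 sigmaH 0 := by
  unfold SPlus
  rw [sPlusB_iff_ringRoomB]
  exact ringRoom_two_closed_sigmaH 2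

/-- σ-generic height-2 item. -/
theorem sPlus_two_sigma (σ : Design → ℤ) (hσ : ∀ D : Design, 28 * (D.copies : ℤ) ≤ σ D) : SPlus 2 σ 0 := by
  unfold SPlus
  rw [sPlusB_iff_ringRoomB]
  exact ringRoom_two_closed_sigma 2 σ hσ

/-! ## §3 Shell 2 in the COPIES currency: `copies ≥ 59` (kernel), so `CopiesLe B` is closed for `B ≤ 58` — and only that is claimed here -/

theorem nmass_le_copies (D : Design) : Nmass D ≤ (D.copies : ℤ) := by
  simp only [Nmass, Design.copies, Nat.cast_add]
  exact le_add_of_nonneg_right (Nat.cast_nonneg _)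

/-- every design of ROOM 2 (with the door of record) has `copies ≥ 59` (from dual's `nmass_ge_59 : 59 ≤ Σ_N m`). -/
theorem copies_ge_59_of_ring_two {h : ℤ} {D : Design} (hA : D.OnAlphabet h) (hR : RingLe 2 D) (hd : Disj D) (hr : RuleD D) (h1 : D.A1)
    (hμ : D.mu ≠ 0) (hp : HallPlusUp D 8) : 59 ≤ (D.copies : ℤ) :=
  le_trans (nmass_ge_59 hA hR hd hr h1 hμ hp) (nmass_le_copies D)

/-- ROOM 2 in the copies currency, for `B ≤ 58`. -/
theorem ringRoom_two_closed_copiesLe (h : ℤ) {B : ℕ} (hB : B ≤ 58) : RingRoomB h (CopiesLe B) 2 := by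
  intro D hA hd h1 hr _ hp hμ hb hR
  have h59 := copies_ge_59_of_ring_two hA hR hd hr h1 hμ hp
  unfold CopiesLe at hb
  have hb' : (D.copies : ℤ) ≤ (B : ℤ) := by exact_mod_cast hb
  have hB' : (B : ℤ) ≤ 58 := by exact_mod_cast hB
  omega

/-- SHELL 2 in the copies currency, for `B ≤ 58`. -/
theorem shell_two_closed_copiesLe (h : ℤ) {B : ℕ} (hB : B ≤ 58) : RingShellB h (CopiesLe B) 2 :=
  ringShellB_of_ringRoomB (ringRoom_two_closed_copiesLe h hB)

/-- the height-2 item in the copies currency, for `B ≤ 58`. -/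
theorem sPlusB_two_copiesLe {B : ℕ} (hB : B ≤ 58) : SPlusB 2 (CopiesLe B) := by
  rw [sPlusB_iff_ringRoomB]
  exact ringRoom_two_closed_copiesLe 2 hB

/-! ### §3b The N-BUDGET under the door of record is RING-INDEPENDENT: `Σ_N m ≤ 58` (and `copies + rank ≤ 116`) at EVERY shell
(director R19.683 (S3-3): «is it still Σ_N ≤ 58 via `budget_eq_two_Nmass`, or what?» — yes, verbatim, at every ring: the identity `copies + rank = 2·Σ_N m` is
arithmetic and `σ ≥ 28·copies` turns the budget clause `σ D + 28·(rank − 4) ≤ 3136` into `copies + rank ≤ 116`; no ring hypothesis is used) -/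

/-- under the budget clause of any `σ ≥ 28·copies`: `copies + rank ≤ 116`, for EVERY design (no ring, door or Hall hypothesis). -/
theorem copies_add_rank_le_116_of_budget (σ : Design → ℤ) {D : Design} (hσ : 28 * (D.copies : ℤ) ≤ σ D) (hb : BudgetClause σ 0 D) :
    (D.copies : ℤ) + D.rank ≤ 116 := by
  unfold BudgetClause at hb
  omega

/-- **the N-budget at every shell:** `Σ_N m ≤ 58` under the budget clause of any `σ ≥ 28·copies` (in particular `σ_H`, by `diag_le_sigmaH`). -/
theorem nmass_le_58_of_budget (σ : Design → ℤ) {D : Design} (hσ : 28 * (D.copies : ℤ) ≤ σ D) (hb : BudgetClause σ 0 D) :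
    Nmass D ≤ 58 := by
  have h1 := copies_add_rank_le_116_of_budget σ hσ hb
  have h2 := budget_eq_two_Nmass D
  omega

/-- the N-budget in the currency of record. -/
theorem nmass_le_58_of_sigmaH_budget {D : Design} (hb : BudgetClause sigmaH 0 D) : Nmass D ≤ 58 :=
  nmass_le_58_of_budget sigmaH (diag_le_sigmaH D) hb

/-- and the P-budget that goes with it under `rank ≥ r`: `Σ_P m = Σ_N m − rank ≤ 58 − r` (so `≤ 50` under the PortHall₈ rank floor `r = 8`). -/
theorem pmass_le_of_budget (σ : Design → ℤ) {D : Design} (hσ : 28 * (D.copies : ℤ) ≤ σ D) (hb : BudgetClause σ 0 D) (r : ℤ)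
    (hr : r ≤ D.rank) : (D.copies : ℤ) - Nmass D ≤ 58 - r := by
  have h1 := copies_add_rank_le_116_of_budget σ hσ hb
  have h2 := budget_eq_two_Nmass D
  omega

/-! ## §4 The RESIDUAL LEDGER: with shells 1 and 2 closed, the statement of record is the conjunction of the twelve shells 3 … 14 -/

/-- σ-generic residual ledger at height 14. -/
theorem sPlusB_sigma_iff_shells_from_three (σ : Design → ℤ) (hσ : ∀ D : Design, 28 * (D.copies : ℤ) ≤ σ D) :
    SPlusB 14 (BudgetClause σ 0) ↔ ∀ c : ℤ, 3 ≤ c → c ≤ 14 → RingShellB 14 (BudgetClause σ 0) c := by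
  constructor
  · intro H c _ _
    exact shells_of_sPlusB H c
  · intro H
    refine sPlusB_of_shells (by norm_num) _ fun c h1 h14 => ?_
    rcases (show c = 1 ∨ c = 2 ∨ 3 ≤ c by omega) with rfl | rfl | h3
    · exact shell_one_closed 14 _
    · exact shell_two_closed_sigma 14 σ hσ
    · exact H c h3 h14

/-- **THE RESIDUAL LEDGER IN THE CURRENCY OF RECORD:** `SPlus 14 σ_H 0 ⟺` shells `3 … 14` of it. -/
theorem sPlus_fourteen_sigmaH_iff_shells_from_three :
    SPlus 14 sigmaH 0 ↔ ∀ c : ℤ, 3 ≤ c → c ≤ 14 → RingShellB 14 (BudgetClause sigmaH 0) c := by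
  unfold SPlus
  exact sPlusB_sigma_iff_shells_from_three sigmaH diag_le_sigmaH

/-- the same at any height `h ≥ 2`: `SPlus h σ_H 0 ⟺` shells `3 … h`. -/
theorem sPlus_sigmaH_iff_shells_from_three {h : ℤ} (hh : 2 ≤ h) :
    SPlus h sigmaH 0 ↔ ∀ c : ℤ, 3 ≤ c → c ≤ h → RingShellB h (BudgetClause sigmaH 0) c := by
  unfold SPlus
  constructor
  · intro H c _ _
    exact shells_of_sPlusB H c
  · intro H
    refine sPlusB_of_shells (by omega) _ fun c h1 hc => ?_
    rcases (show c = 1 ∨ c = 2 ∨ 3 ≤ c by omega) with rfl | rfl | h3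
    · exact shell_one_closed h _
    · exact shell_two_closed_sigmaH h
    · exact H c h3 hc

/-- the LARGEST KERNEL-CLOSED INITIAL SEGMENT of the ledger: rooms `≤ 2` at height 14 in the currency of record; the next row is shell 3. -/
theorem ringRoom_fourteen_two_closed_sigmaH : RingRoomB 14 (BudgetClause sigmaH 0) 2 :=
  ringRoom_two_closed_sigmaH 14

/-- the ledger step at the front: room 3 closes iff shell 3 does. -/
theorem ringRoom_three_iff_shell_three_sigmaH :
    RingRoomB 14 (BudgetClause sigmaH 0) 3 ↔ RingShellB 14 (BudgetClause sigmaH 0) 3 := by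
  have e := ringRoomB_succ_iff 14 (BudgetClause sigmaH 0) (c := 2) (by norm_num)
  norm_num at e
  constructor
  · intro H; exact (e.mp H).2
  · intro H; exact e.mpr ⟨ringRoom_two_closed_sigmaH 14, H⟩

/-! ## §5 Dictionary of each open shell to the height-`c` item (shift by `14 − c`; `σ_H` is shift-invariant) -/

theorem budgetClause_sigmaH_shiftD (π t : ℤ) (D : Design) :
    BudgetClause sigmaH π (shiftD t D) ↔ BudgetClause sigmaH π D :=
  budgetClause_shiftD sigmaH π sigmaH_shiftD t D

/-- shell `c` at height 14 ⟺ the FLOOR-FREE form of the height-`c` item, in the currency of record. -/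
theorem shell_sigmaH_iff_floorFreeB {c : ℤ} (h1c : 1 ≤ c) (hc : c ≤ 14) :
    RingShellB 14 (BudgetClause sigmaH 0) c ↔ FloorFreeB c (BudgetClause sigmaH 0) :=
  ringShellB_iff_floorFreeB h1c hc (budgetClause_sigmaH_shiftD 0)

/-- room `c` at height 14 ⟺ the height-`c` item `SPlus c σ_H 0`. -/
theorem ringRoom_sigmaH_iff_sPlus {c : ℤ} (hc : c ≤ 14) :
    RingRoomB 14 (BudgetClause sigmaH 0) c ↔ SPlus c sigmaH 0 := by
  unfold SPlus
  exact ringRoomB_iff_sPlusB hc (budgetClause_sigmaH_shiftD 0)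

/-- **THE STATEMENT OF RECORD AS TWELVE HEIGHT-`c` ITEMS:** `SPlus 14 σ_H 0 ⟺ ∀ c ∈ [3, 14], FloorFreeB c (BudgetClause σ_H 0)`. -/
theorem sPlus_fourteen_sigmaH_iff_floorFree_from_three :
    SPlus 14 sigmaH 0 ↔ ∀ c : ℤ, 3 ≤ c → c ≤ 14 → FloorFreeB c (BudgetClause sigmaH 0) := by
  rw [sPlus_fourteen_sigmaH_iff_shells_from_three]
  constructor
  · intro H c h3 h14
    exact (shell_sigmaH_iff_floorFreeB (by omega) h14).mp (H c h3 h14)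
  · intro H c h3 h14
    exact (shell_sigmaH_iff_floorFreeB (by omega) h14).mpr (H c h3 h14)

end Summit.HodgeConjecture.HodgeConjecture.Cruxes.BlochSeedDiscOne.ShellLedger
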